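import Summits.CriticalPhenomena.PercolationContinuityZ3.Theorems.Transplant.Slab111HubEntry
import HarnessLib

/-!
# The HUB ROUTING of the `(111)`-films, X: the BOOLEAN CHECKER of dispatcher entries (`Entry.okB`) and its soundness

builds on p205010 (kernel theorem, internal audit signed; external expert review pending) — NOT used in this file.  Lane `prim-bschramm`, seat
`prim-bschramm-p2` (gen 36; class C1b; memo `HOME/bschramm/P2-LATTICES.md` §130); helper file (`--supports stmt-CriticalPhenomena-4575 --as helper`).
The per-shape dispatcher tables are certified by KERNEL EVALUATION (`decide`) of a plain Boolean function — «Slab111VPlan»/«Slab111VFast» pattern —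
not of the `Decidable` instances of «Slab111HubEntry».`Entry.ok` (which do not reduce in the kernel).  This file: explicit Boolean versions of
`IsUp`, `FaceD.ok`, `OffHub`, `Disj`, `Att`, `RAdm`, `MStep`, chains, `Nodup`, `LegOK`, `LegFits`, `LegAvoids`, and **`Entry.okB`**, with the
soundness theorem **`Entry.ok_of_okB`**.
[cite: DuminilCopinSidoraviciusTassion2016, §2.3 (proof of Fact 2: the three disjoint paths γ_u, γ_v, γ_w in B_R(z))]
-/

namespace Summit.CriticalPhenomena.PercolationContinuityZ3.Theorems.Transplant

namespace Slab111

/-! ## §1 Boolean primitives -/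

/-- `IsUp` as an explicit Boolean. [folklore] -/
def isUpB' (p q : ℤ × ℤ) : Bool :=
  (q.1 == p.1 + 1 && q.2 == p.2) || (q.1 == p.1 && q.2 == p.2 - 1) || (q.1 == p.1 - 1 && q.2 == p.2 + 1)

/-- Soundness of `isUpB'`. [folklore] -/
theorem isUp_of_B {p q : ℤ × ℤ} (h : isUpB' p q = true) : IsUp p q := by
  unfold isUpB' at h; unfold IsUp
  simp only [Bool.or_eq_true, Bool.and_eq_true, beq_iff_eq, or_assoc] at h
  exact h

/-- `FaceD.ok` as an explicit Boolean. [folklore] -/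
def faceOkB (F : FaceD) : Bool :=
  (F.f0.1 + 2 * F.f0.2) % 3 == 0 && (F.f1.1 + 2 * F.f1.2 - 1) % 3 == 0 && (F.f2.1 + 2 * F.f2.2 - 2) % 3 == 0 &&
    isUpB' F.f0 F.f1 && isUpB' F.f1 F.f2 && isUpB' F.f2 F.f0

/-- Soundness of `faceOkB`. [folklore] -/
theorem faceOk_of_B {F : FaceD} (h : faceOkB F = true) : F.ok := by
  unfold faceOkB at h
  simp only [Bool.and_eq_true, beq_iff_eq] at h
  obtain ⟨⟨⟨⟨⟨h0, h1⟩, h2⟩, u0⟩, u1⟩, u2⟩ := h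
  exact ⟨Int.dvd_of_emod_eq_zero h0, Int.dvd_of_emod_eq_zero h1, Int.dvd_of_emod_eq_zero h2, isUp_of_B u0, isUp_of_B u1, isUp_of_B u2⟩

/-- `FaceD.OffHub` as a Boolean. [folklore] -/
def offHubB (F : FaceD) : Bool := F.f0 != (0, 0) && F.f1 != (0, 0) && F.f2 != (0, 0)

/-- Soundness of `offHubB`. [folklore] -/
theorem offHub_of_B {F : FaceD} (h : offHubB F = true) : F.OffHub := by
  unfold offHubB at h
  simp only [Bool.and_eq_true, bne_iff_ne, ne_eq] at h
  exact ⟨h.1.1, h.1.2, h.2⟩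

/-- `FaceD.Disj` as a Boolean. [folklore] -/
def disjB (F G : FaceD) : Bool :=
  F.f0 != G.f0 && F.f0 != G.f1 && F.f0 != G.f2 && F.f1 != G.f0 && F.f1 != G.f1 && F.f1 != G.f2 && F.f2 != G.f0 && F.f2 != G.f1 && F.f2 != G.f2

/-- Soundness of `disjB`. [folklore] -/
theorem disj_of_B {F G : FaceD} (h : disjB F G = true) : F.Disj G := by
  unfold disjB at h
  simp only [Bool.and_eq_true, bne_iff_ne, ne_eq] at h
  obtain ⟨⟨⟨⟨⟨⟨⟨⟨a, b⟩, c⟩, d⟩, e⟩, f⟩, g⟩, i⟩, j⟩ := h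
  exact ⟨a, b, c, d, e, f, g, i, j⟩

/-- `Att` as a Boolean. [folklore] -/
def attB (F : FaceD) (d : ℤ) : Bool :=
  (d == 1 && (F.f1 == (1, 0) || F.f1 == (0, -1) || F.f1 == (-1, 1))) || (d == -1 && (F.f2 == (-1, 0) || F.f2 == (0, 1) || F.f2 == (1, -1)))

/-- Soundness of `attB`. [folklore] -/
theorem att_of_B {F : FaceD} {d : ℤ} (h : attB F d = true) : Att F d := by
  unfold attB at h
  simp only [Bool.or_eq_true, Bool.and_eq_true, beq_iff_eq, or_assoc] at h
  rcases h with ⟨hd, hu⟩ | ⟨hd, hu⟩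
  · exact Or.inl ⟨hd, hu⟩
  · exact Or.inr ⟨hd, hu⟩

/-- Face membership as a Boolean. [folklore] -/
def faceMemB (F : FaceD) (c : ℤ × ℤ) : Bool := c == F.f0 || c == F.f1 || c == F.f2

/-- `faceMemB` decides `FaceD.mem`. [folklore] -/
theorem faceMemB_iff (F : FaceD) (c : ℤ × ℤ) : faceMemB F c = true ↔ F.mem c := by
  unfold faceMemB FaceD.mem; simp only [Bool.or_eq_true, beq_iff_eq, or_assoc]

/-- List membership of a column as a Boolean. [folklore] -/
def memB (q : ℤ × ℤ) (C : List (ℤ × ℤ)) : Bool := C.any (fun c => c == q)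

/-- Soundness of `memB`. [folklore] -/
theorem mem_of_memB {q : ℤ × ℤ} {C : List (ℤ × ℤ)} (h : memB q C = true) : q ∈ C := by
  unfold memB at h
  rw [List.any_eq_true] at h
  obtain ⟨c, hc, e⟩ := h
  rw [beq_iff_eq] at e
  exact e ▸ hc

/-! ## §2 Legs -/

/-- `RAdm` as a Boolean. [folklore] -/
def radmB (p : MV) : Bool := (p.2 - (p.1.1 + 2 * p.1.2)) % 3 == 0

/-- Soundness of `radmB`. [folklore] -/
theorem radm_of_B {p : MV} (h : radmB p = true) : RAdm p := by
  unfold radmB at h; rw [beq_iff_eq] at h; exact Int.dvd_of_emod_eq_zero h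

/-- `MStep` as an explicit Boolean. [folklore] -/
def mstepB' (p q : MV) : Bool :=
  (q.2 == p.2 + 1 && ((q.1.1 == p.1.1 + 1 && q.1.2 == p.1.2) || (q.1.1 == p.1.1 && q.1.2 == p.1.2 - 1) || (q.1.1 == p.1.1 - 1 && q.1.2 == p.1.2 + 1))) ||
  (p.2 == q.2 + 1 && ((p.1.1 == q.1.1 + 1 && p.1.2 == q.1.2) || (p.1.1 == q.1.1 && p.1.2 == q.1.2 - 1) || (p.1.1 == q.1.1 - 1 && p.1.2 == q.1.2 + 1)))

/-- Soundness of `mstepB'`. [folklore] -/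
theorem mstep_of_B {p q : MV} (h : mstepB' p q = true) : MStep p q := by
  unfold mstepB' at h
  simp only [Bool.or_eq_true, Bool.and_eq_true, beq_iff_eq, or_assoc] at h
  exact h

/-- Chain of model steps as a Boolean. [folklore] -/
def chainB' : List MV → Bool
  | [] => true
  | [_] => true
  | a :: b :: l => mstepB' a b && chainB' (b :: l)

/-- Soundness of `chainB'`. [folklore] -/
theorem isChain_of_chainB' : ∀ {l : List MV}, chainB' l = true → l.IsChain MStep
  | [], _ => List.IsChain.nil
  | [_], _ => List.IsChain.singleton _
  | a :: b :: l, h => by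
    unfold chainB' at h
    rw [Bool.and_eq_true] at h
    exact List.IsChain.cons_cons (mstep_of_B h.1) (isChain_of_chainB' h.2)

/-- Duplicate-freeness as a Boolean. [folklore] -/
def nodupB : List MV → Bool
  | [] => true
  | a :: l => !(l.any (fun b => b == a)) && nodupB l

/-- Soundness of `nodupB`. [folklore] -/
theorem nodup_of_nodupB : ∀ {l : List MV}, nodupB l = true → l.Nodup
  | [], _ => List.nodup_nil
  | a :: l, h => by
    unfold nodupB at h
    rw [Bool.and_eq_true, Bool.not_eq_true'] at h
    refine List.nodup_cons.2 ⟨fun ha => ?_, nodup_of_nodupB h.2⟩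
    have : l.any (fun b => b == a) = true := List.any_eq_true.2 ⟨a, ha, by simp⟩
    rw [this] at h; exact Bool.noConfusion h.1

/-- `LegOK` as a Boolean. [folklore] -/
def legOKB (l : List MV) : Bool :=
  !l.isEmpty && l.head? == some ((0, 0), 0) && chainB' l && nodupB l && l.all radmB

/-- Soundness of `legOKB`. [folklore] -/
theorem legOK_of_B {l : List MV} (h : legOKB l = true) : LegOK l := by
  unfold legOKB at h
  simp only [Bool.and_eq_true, Bool.not_eq_true', List.all_eq_true] at h
  obtain ⟨⟨⟨⟨hne, hhead⟩, hch⟩, hnd⟩, hadm⟩ := h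
  refine ⟨fun e => by rw [e] at hne; simp at hne, ?_, isChain_of_chainB' hch, nodup_of_nodupB hnd, fun p hp => radm_of_B (hadm p hp)⟩
  rw [beq_iff_eq] at hhead; exact hhead

/-- `LegFits` as a Boolean. [folklore] -/
def legFitsB (l : List MV) (q : ℤ × ℤ) (F : FaceD) (C : List (ℤ × ℤ)) (dir Λ : ℤ) : Bool :=
  legOKB l &&
    match l.getLast? with
    | none => false
    | some e =>
      faceMemB F (q + e.1) && decide (0 ≤ dir * e.2) && decide (dir * e.2 ≤ Λ) &&
        l.all (fun p => p == e || !faceMemB F (q + p.1)) &&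
        l.all (fun p => p == ((0, 0), 0) || (memB (q + p.1) C && decide (1 ≤ dir * p.2) && decide (dir * p.2 ≤ Λ)))

/-- Soundness of `legFitsB`. [folklore] -/
theorem legFits_of_B {l : List MV} {q : ℤ × ℤ} {F : FaceD} {C : List (ℤ × ℤ)} {dir Λ : ℤ} (h : legFitsB l q F C dir Λ = true) :
    LegFits l q F C dir Λ := by
  unfold legFitsB at h
  rw [Bool.and_eq_true] at h
  obtain ⟨hok, hrest⟩ := h
  have hl := legOK_of_B hok
  have hlast : l.getLast? = some (l.getLast hl.1) := List.getLast?_eq_some_getLast hl.1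
  rw [hlast] at hrest
  simp only [Bool.and_eq_true, Bool.or_eq_true, decide_eq_true_eq, List.all_eq_true, Bool.not_eq_true', beq_iff_eq] at hrest
  obtain ⟨⟨⟨⟨hmem, h0⟩, hΛ⟩, hoff⟩, hreg⟩ := hrest
  refine ⟨hl, (faceMemB_iff F _).1 hmem, h0, hΛ, fun p hp hne => ?_, fun p hp hne => ?_⟩
  · rcases hoff p hp with e | e
    · exact absurd e hne
    · rw [← Bool.not_eq_true, faceMemB_iff] at e; exact e
  · rcases hreg p hp with e | ⟨⟨hm, h1⟩, h2⟩
    · exact absurd e hne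
    · exact ⟨mem_of_memB hm, h1, h2⟩

/-- `LegAvoids` as a Boolean. [folklore] -/
def legAvoidsB (l : List MV) (q : ℤ × ℤ) (G : FaceD) : Bool :=
  match l.getLast? with
  | none => true
  | some e => l.all (fun p => p == e || !faceMemB G (q + p.1))

/-- Soundness of `legAvoidsB`. [folklore] -/
theorem legAvoids_of_B {l : List MV} {q : ℤ × ℤ} {G : FaceD} (h : legAvoidsB l q G = true) : LegAvoids l q G := by
  intro p hp ⟨hne, hpl⟩
  unfold legAvoidsB at h
  rw [List.getLast?_eq_some_getLast hne] at h
  simp only [List.all_eq_true, Bool.or_eq_true, beq_iff_eq, Bool.not_eq_true'] at h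
  rcases h p hp with e | e
  · exact absurd e hpl
  · rw [← Bool.not_eq_true, faceMemB_iff] at e; exact e

/-! ## §3 Entries -/

/-- **`Entry.ok` as a Boolean.** [folklore] -/
def Entry.okB (e : Entry) (Pc Wc : List (ℤ × ℤ)) (q₁ q₂ q₃ : ℤ × ℤ) (dir₁ dir₂ dir₃ Λ : ℤ) (x21 x31 x12 x32 x13 x23 : Bool) : Bool :=
  faceOkB e.F1 && faceOkB e.F2 && faceOkB e.F3 && offHubB e.F1 && offHubB e.F2 && offHubB e.F3 &&
  disjB e.F1 e.F2 && disjB e.F1 e.F3 && disjB e.F2 e.F3 && attB e.F1 e.d₁ && attB e.F2 e.d₂ && attB e.F3 e.d₃ &&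
  (memB e.F1.f0 Pc && memB e.F1.f1 Pc && memB e.F1.f2 Pc) && (memB e.F2.f0 Pc && memB e.F2.f1 Pc && memB e.F2.f2 Pc) &&
  (memB e.F3.f0 Wc && memB e.F3.f1 Wc && memB e.F3.f2 Wc) && memB (0, 0) Pc &&
  legFitsB e.l₁ q₁ e.F1 Pc dir₁ Λ && legFitsB e.l₂ q₂ e.F2 Pc dir₂ Λ && legFitsB e.l₃ q₃ e.F3 Wc dir₃ Λ &&
  (!x21 || legAvoidsB e.l₁ q₁ e.F2) && (!x31 || legAvoidsB e.l₁ q₁ e.F3) && (!x12 || legAvoidsB e.l₂ q₂ e.F1) &&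
  (!x32 || legAvoidsB e.l₂ q₂ e.F3) && (!x13 || legAvoidsB e.l₃ q₃ e.F1) && (!x23 || legAvoidsB e.l₃ q₃ e.F2)

/-- An implication bit. [folklore] -/
theorem imp_of_B {x b : Bool} (h : (!x || b) = true) (hx : x = true) : b = true := by
  rw [hx] at h; simpa using h

/-- **SOUNDNESS OF THE BOOLEAN CHECKER.** [folklore] -/
theorem Entry.ok_of_okB {e : Entry} {Pc Wc : List (ℤ × ℤ)} {q₁ q₂ q₃ : ℤ × ℤ} {dir₁ dir₂ dir₃ Λ : ℤ} {x21 x31 x12 x32 x13 x23 : Bool}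
    (h : e.okB Pc Wc q₁ q₂ q₃ dir₁ dir₂ dir₃ Λ x21 x31 x12 x32 x13 x23 = true) : e.ok Pc Wc q₁ q₂ q₃ dir₁ dir₂ dir₃ Λ x21 x31 x12 x32 x13 x23 := by
  unfold Entry.okB at h
  simp only [Bool.and_eq_true, and_assoc] at h
  obtain ⟨hF1, hF2, hF3, ho1, ho2, ho3, h12, h13, h23, hA1, hA2, hA3, p10, p11, p12, p20, p21, p22, w30, w31, w32, hhub, hl1, hl2, hl3,
    hx21, hx31, hx12, hx32, hx13, hx23⟩ := h
  exact ⟨faceOk_of_B hF1, faceOk_of_B hF2, faceOk_of_B hF3, offHub_of_B ho1, offHub_of_B ho2, offHub_of_B ho3, disj_of_B h12, disj_of_B h13,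
    disj_of_B h23, att_of_B hA1, att_of_B hA2, att_of_B hA3, ⟨mem_of_memB p10, mem_of_memB p11, mem_of_memB p12⟩,
    ⟨mem_of_memB p20, mem_of_memB p21, mem_of_memB p22⟩, ⟨mem_of_memB w30, mem_of_memB w31, mem_of_memB w32⟩, mem_of_memB hhub,
    legFits_of_B hl1, legFits_of_B hl2, legFits_of_B hl3,
    fun hx => legAvoids_of_B (imp_of_B hx21 hx), fun hx => legAvoids_of_B (imp_of_B hx31 hx), fun hx => legAvoids_of_B (imp_of_B hx12 hx),
    fun hx => legAvoids_of_B (imp_of_B hx32 hx), fun hx => legAvoids_of_B (imp_of_B hx13 hx), fun hx => legAvoids_of_B (imp_of_B hx23 hx)⟩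

end Slab111

end Summit.CriticalPhenomena.PercolationContinuityZ3.Theorems.Transplant
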